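/-
Copyright (c) 2026 the pub-hodgecm-mathlib formalisation cell (harness21).  Prover seat hodgecm-mathlib-K2Liu-p11 (g0), Track B «K2-LIT»,
#184♮ = hLiu418 = `stmt-HodgeConjecture-24832`; LEAD F0P6-plan (g13) RULINGS M-157f/M-157g «(A∞-B) := K2LiuHermTwoXiZeroValue, ONE S FILE».
File (A∞-B), FILE 1 of 2: the value of Shimura's `ξ(g, 0; α, β)` on `Herm₂(ℂ)` (pure `Herm₂` side, on K2E5-p16 (g5)'s ★ names).  THEOREMS ONLY.
-/
import Summits.HodgeConjecture.HodgeConjecture.Theorems.K2LiuHermTwoXiEtaIdentitySemidefinite   -- ★ K2E5-p16 (g5): `xiTwo_eq_etaTwo_of_posSemidef`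
import Summits.HodgeConjecture.HodgeConjecture.Theorems.K2LiuHermTwoGammaSiegelGindikin         -- ★ K2E5-p16 (g5): `integral_siegelGindikin`, `det_eq_ofReal_of_posDef`
import Summits.HodgeConjecture.HodgeConjecture.Theorems.K2LiuHermTwoConfluentXiHolomorphy       -- ★ K2E5-p16 (g5): `differentiableOn_xiTwo_diag`
import HarnessLib

/-!
# Crux `HLiu418`, A∞ organ, (A∞-B) FILE 1: `ξ(g, 0; α, β) = 4π⁴ e^{iπ(β−α)} Γ₂(α+β−2) Γ₂(α)⁻¹ Γ₂(β)⁻¹ det(2g)^{2−α−β}`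

Cell `hodgecm-mathlib`, crux item hLiu418 = `stmt-HodgeConjecture-24832` (helper lane `--supports`, count-neutral).

The base integral of the A∞ organ (the local archimedean intertwining operator of `U(2,2)` at a complex place on the scalar `K`-type,
★ `K2LiuArchInducedTubeSection.archIntertwining_archScalarSection_one`) is Shimura's confluent hypergeometric function
`ξ(g, h; α, β) = ∫_{Herm₂(ℂ)} e(−tr(hx)) det(x + ig)^{−α} det(x − ig)^{−β} dx` (★ `xiTwo`) AT `h = 0`.  This file evaluates it:
* §1 `etaTwo_zero_right` — at `h = 0` Shimura's `η` collapses to the Siegel–Gindikin gamma integral of the cone: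
  `η(g, 0; α, β) = Γ₂(α+β−2) · det(g)^{−(α+β−2)}` for `g > 0`, `3 < re(α+β)` (★ `integral_siegelGindikin`);
* §2 `xiTwo_zero_right_of_re` — `ξ(g, 0; α, β) = 4π⁴ · e^{iπ(β−α)} · Γ₂(α)⁻¹ Γ₂(β)⁻¹ · Γ₂(α+β−2) · det(2g)^{−(α+β−2)}` on `{3 < re α, 1 < re β}`
  (★ `xiTwo_eq_etaTwo_of_posSemidef` at `h = 0` + §1);
* §3 `xiTwo_zero_right` — the SAME closed form on the whole half-space of absolute convergence `{3 < re(α+β)}`, by the identity theorem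
  along the diagonal `t ↦ (α+t, β+t)` (★ `differentiableOn_xiTwo_diag`; the right-hand side is holomorphic there: `1/Γ` is entire,
  `Γ₂` is holomorphic on `{1 < re}`).
FILE 2 (`K2LiuArchIntertwiningScalarValue`) transports this to the (D∞) coordinates `hermOfReal` and reads off the scalar `c_k(s)`.
References: [Shimura1982, (1.16), (1.29)–(1.31), Case II, m = κ = 2] (derived here from ★, not cited).
HONEST LABEL: HC_CM is proved only modulo the 7 printed citations (2 remaining named inputs: hLiu418 = stmt-HodgeConjecture-24832,
h413 = stmt-HodgeConjecture-24833) until rung 0 closes; count-neutral helper, closes no socket.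
-/

set_option autoImplicit false
set_option linter.dupNamespace false

noncomputable section

open Complex MeasureTheory Set
open scoped ComplexOrder

namespace Summit.HodgeConjecture.HodgeConjecture.Cruxes.HLiu418.K2LiuHermTwoXiZeroValue

open Summit.HodgeConjecture.HodgeConjecture.Cruxes.HLiu418.K2LiuHermTwoGammaDefs
open Summit.HodgeConjecture.HodgeConjecture.Cruxes.HLiu418.K2LiuHermTwoGammaSiegelGindikin
open Summit.HodgeConjecture.HodgeConjecture.Cruxes.HLiu418.K2LiuHermTwoEtaDefs
open Summit.HodgeConjecture.HodgeConjecture.Cruxes.HLiu418.K2LiuHermTwoConfluentXiDefs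
open Summit.HodgeConjecture.HodgeConjecture.Cruxes.HLiu418.K2LiuHermTwoConfluentXiHolomorphy
open Summit.HodgeConjecture.HodgeConjecture.Cruxes.HLiu418.K2LiuHermTwoXiEtaIdentitySemidefinite

/-! ## §1  `η(g, 0; α, β)` is a Siegel–Gindikin integral -/

/-- **`η` AT `h = 0`**: for `g > 0` and `3 < re(α+β)`, `η(g, 0; α, β) = Γ₂(α+β−2) · det(g)^{−(α+β−2)}`
([Shimura1982, (1.16)/(1.31) at `h = 0`]; the two determinant powers merge on the cone, where `det x` is a positive real). -/
theorem etaTwo_zero_right {g : Matrix (Fin 2) (Fin 2) ℂ} (hg : g.PosDef) {α β : ℂ} (hαβ : 3 < (α + β).re) :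
    etaTwo g 0 α β = hermTwoGamma (α + β - 2) * g.det ^ (-(α + β - 2)) := by
  have hs : 1 < (α + β - 2).re := by
    rw [Complex.sub_re, Complex.re_ofNat]
    linarith
  rw [etaTwo_def, etaTwoSet_eq_of_posSemidef Matrix.PosSemidef.zero, ← integral_siegelGindikin hg hs]
  simp only [sub_zero]
  refine setIntegral_congr_fun measurableSet_posDef_hermTwo fun c hc => ?_
  have hd : (hermTwo c).det ≠ 0 := by
    obtain ⟨hdet, hpos⟩ := det_eq_ofReal_of_posDef hc
    rw [hdet]
    exact_mod_cast hpos.ne'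
  rw [etaTwoIntegrand_apply, add_zero, sub_zero, ← Complex.cpow_add _ _ hd]
  congr 2
  ring

/-! ## §2  `ξ(g, 0; α, β)` on `{3 < re α, 1 < re β}` -/

/-- `2 • g` is positive definite for positive definite `g`. [folklore] -/
theorem posDef_two_smul {g : Matrix (Fin 2) (Fin 2) ℂ} (hg : g.PosDef) : ((2 : ℂ) • g).PosDef := by
  rw [two_smul]
  exact hg.add_posSemidef hg.posSemidef

/-- **`ξ` AT `h = 0`, the range of the `ξ–η` identity**: for `g > 0`, `3 < re α`, `1 < re β`,
`ξ(g, 0; α, β) = 4π⁴ · e^{iπ(β−α)} · Γ₂(α)⁻¹ · Γ₂(β)⁻¹ · (Γ₂(α+β−2) · det(2g)^{−(α+β−2)})` ([Shimura1982, (1.29)+(1.31), `h = 0`]). -/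
theorem xiTwo_zero_right_of_re {g : Matrix (Fin 2) (Fin 2) ℂ} (hg : g.PosDef) {α β : ℂ} (hα : 3 < α.re) (hβ : 1 < β.re) :
    xiTwo g 0 α β =
      ((4 * Real.pi ^ 4 : ℝ) : ℂ) * cexp ((Real.pi * I) * (β - α)) * (hermTwoGamma α)⁻¹ * (hermTwoGamma β)⁻¹ *
        (hermTwoGamma (α + β - 2) * ((2 : ℂ) • g).det ^ (-(α + β - 2))) := by
  have hαβ : 3 < (α + β).re := by
    rw [Complex.add_re]
    linarith
  rw [xiTwo_eq_etaTwo_of_posSemidef hg Matrix.PosSemidef.zero hα hβ, smul_zero, etaTwo_zero_right (posDef_two_smul hg) hαβ]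

/-! ## §3  `ξ(g, 0; α, β)` on the whole half-space `{3 < re(α+β)}` -/

/-- `t ↦ Γ₂(z + t)⁻¹` is entire (`1/Γ` is entire). [folklore] -/
theorem differentiable_inv_hermTwoGamma_add (z : ℂ) : Differentiable ℂ fun t : ℂ => (hermTwoGamma (z + t))⁻¹ := by
  have h : (fun t : ℂ => (hermTwoGamma (z + t))⁻¹) =
      fun t : ℂ => ((Real.pi : ℂ))⁻¹ * (Complex.Gamma (z + t))⁻¹ * (Complex.Gamma (z - 1 + t))⁻¹ := by
    funext t
    rw [hermTwoGamma_def, mul_inv, mul_inv, show z + t - 1 = z - 1 + t by ring]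
  rw [h]
  have hz : Differentiable ℂ fun t : ℂ => z + t := (differentiable_const z).add differentiable_id
  have hz1 : Differentiable ℂ fun t : ℂ => z - 1 + t := (differentiable_const (z - 1)).add differentiable_id
  exact ((differentiable_const _).mul (Complex.differentiable_one_div_Gamma.comp hz)).mul
    (Complex.differentiable_one_div_Gamma.comp hz1)

/-- The closed form `t ↦ 4π⁴ e^{iπ((β+t)−(α+t))} Γ₂(α+t)⁻¹ Γ₂(β+t)⁻¹ (Γ₂(α+β+2t−2) · d^{−(α+β+2t−2)})` (with `d ≠ 0`) is holomorphic on
`{t | 3 < re(α+β+2t)}`. [folklore] -/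
theorem differentiableOn_closedForm (α β : ℂ) {d : ℂ} (hd : d ≠ 0) :
    DifferentiableOn ℂ (fun t : ℂ =>
      ((4 * Real.pi ^ 4 : ℝ) : ℂ) * cexp ((Real.pi * I) * ((β + t) - (α + t))) * (hermTwoGamma (α + t))⁻¹ * (hermTwoGamma (β + t))⁻¹ *
        (hermTwoGamma ((α + t) + (β + t) - 2) * d ^ (-((α + t) + (β + t) - 2))))
      {t : ℂ | 3 < (α + β + 2 * t).re} := by
  intro t ht
  have ht' : 3 < α.re + β.re + 2 * t.re := by
    simpa only [Set.mem_setOf_eq, Complex.add_re, Complex.mul_re, Complex.re_ofNat, Complex.im_ofNat, zero_mul, sub_zero] using ht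
  have hlin : DifferentiableAt ℂ (fun t : ℂ => (α + t) + (β + t) - 2) t := by fun_prop
  have hΓ : DifferentiableAt ℂ (fun t : ℂ => hermTwoGamma ((α + t) + (β + t) - 2)) t := by
    refine (differentiableAt_hermTwoGamma ?_).comp t hlin
    simp only [Complex.add_re, Complex.sub_re, Complex.re_ofNat]
    linarith
  have hpow : DifferentiableAt ℂ (fun t : ℂ => d ^ (-((α + t) + (β + t) - 2))) t :=
    DifferentiableAt.const_cpow hlin.neg (Or.inl hd)
  have hexp : DifferentiableAt ℂ (fun t : ℂ => cexp ((Real.pi * I) * ((β + t) - (α + t)))) t := by fun_prop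
  exact ((((differentiableAt_const _).mul hexp).mul (differentiable_inv_hermTwoGamma_add α t)).mul
    (differentiable_inv_hermTwoGamma_add β t)).mul (hΓ.mul hpow) |>.differentiableWithinAt

/-- **`ξ` AT `h = 0` ON THE HALF-SPACE OF ABSOLUTE CONVERGENCE** (the (A∞-B) face): for `g > 0` and `3 < re(α+β)`,
`ξ(g, 0; α, β) = 4π⁴ · e^{iπ(β−α)} · Γ₂(α)⁻¹ · Γ₂(β)⁻¹ · (Γ₂(α+β−2) · det(2g)^{−(α+β−2)})`.
Proof: both sides are holomorphic in `t` along `(α+t, β+t)` on the half-plane `{3 < re(α+β+2t)}` (★ `differentiableOn_xiTwo_diag`,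
`differentiableOn_closedForm`) and agree for `t` real and large (§2); identity theorem, then `t = 0`. [Shimura1982, (1.31), `h = 0`]. -/
theorem xiTwo_zero_right {g : Matrix (Fin 2) (Fin 2) ℂ} (hg : g.PosDef) {α β : ℂ} (hαβ : 3 < (α + β).re) :
    xiTwo g 0 α β =
      ((4 * Real.pi ^ 4 : ℝ) : ℂ) * cexp ((Real.pi * I) * (β - α)) * (hermTwoGamma α)⁻¹ * (hermTwoGamma β)⁻¹ *
        (hermTwoGamma (α + β - 2) * ((2 : ℂ) • g).det ^ (-(α + β - 2))) := by
  -- the two holomorphic functions of `t`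
  have hd : ((2 : ℂ) • g).det ≠ 0 := (posDef_two_smul hg).det_pos.ne'
  have hU : IsOpen {t : ℂ | 3 < (α + β + 2 * t).re} := isOpen_lt continuous_const (Complex.continuous_re.comp (by fun_prop))
  have hUeq : {t : ℂ | 3 < (α + β + 2 * t).re} = {t : ℂ | (3 - (α + β).re) / 2 < t.re} := by
    ext t
    simp only [Set.mem_setOf_eq, Complex.add_re, Complex.mul_re, Complex.re_ofNat, Complex.im_ofNat, zero_mul, sub_zero]
    constructor <;> intro h <;> linarith
  have hUconn : IsPreconnected {t : ℂ | 3 < (α + β + 2 * t).re} := by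
    rw [hUeq]
    exact (convex_halfSpace_re_gt _).isPreconnected
  have hF := (differentiableOn_xiTwo_diag hg (h := 0) Matrix.isHermitian_zero α β).analyticOnNhd hU
  have hG := (differentiableOn_closedForm α β hd).analyticOnNhd hU
  -- a real base point deep inside `{3 < re(α+t), 1 < re(β+t)}`
  obtain ⟨t₀, ht₀⟩ : ∃ t₀ : ℝ, 3 - α.re < t₀ ∧ 1 - β.re < t₀ :=
    ⟨max (3 - α.re) (1 - β.re) + 1, by linarith [le_max_left (3 - α.re) (1 - β.re)], by linarith [le_max_right (3 - α.re) (1 - β.re)]⟩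
  have ht₀U : (t₀ : ℂ) ∈ {t : ℂ | 3 < (α + β + 2 * t).re} := by
    simp only [Set.mem_setOf_eq, Complex.add_re, Complex.mul_re, Complex.re_ofNat, Complex.im_ofNat, Complex.ofReal_re,
      Complex.ofReal_im, mul_zero, sub_zero]
    linarith
  -- near `t₀` the two functions agree by §2
  have hV : IsOpen {t : ℂ | 3 < (α + t).re ∧ 1 < (β + t).re} :=
    (isOpen_lt continuous_const (Complex.continuous_re.comp (by fun_prop))).inter
      (isOpen_lt continuous_const (Complex.continuous_re.comp (by fun_prop)))
  have ht₀V : (t₀ : ℂ) ∈ {t : ℂ | 3 < (α + t).re ∧ 1 < (β + t).re} := by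
    simp only [Set.mem_setOf_eq, Complex.add_re, Complex.ofReal_re]
    constructor <;> linarith
  have hev : (fun t : ℂ => xiTwo g 0 (α + t) (β + t)) =ᶠ[nhds (t₀ : ℂ)] (fun t : ℂ =>
      ((4 * Real.pi ^ 4 : ℝ) : ℂ) * cexp ((Real.pi * I) * ((β + t) - (α + t))) * (hermTwoGamma (α + t))⁻¹ * (hermTwoGamma (β + t))⁻¹ *
        (hermTwoGamma ((α + t) + (β + t) - 2) * ((2 : ℂ) • g).det ^ (-((α + t) + (β + t) - 2)))) := by
    filter_upwards [hV.mem_nhds ht₀V] with t ht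
    exact xiTwo_zero_right_of_re hg ht.1 ht.2
  have hEq := hF.eqOn_of_preconnected_of_eventuallyEq hG hUconn ht₀U hev
  have h0 : (0 : ℂ) ∈ {t : ℂ | 3 < (α + β + 2 * t).re} := by
    simp only [Set.mem_setOf_eq, mul_zero, add_zero]
    exact hαβ
  have h := hEq h0
  simp only [add_zero] at h
  exact h

end Summit.HodgeConjecture.HodgeConjecture.Cruxes.HLiu418.K2LiuHermTwoXiZeroValue

end
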